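import Summits.CriticalPhenomena.SAWScalingLimit.Theorems.SAWDevelopingMapObservableToSLERestrictionCocycleHelpersPackage
import HarnessLib

/-!
# Crux `HexConjecture` (stmt-CriticalPhenomena-0808), line `root-locality-replaces-loewner`:
growth of the floor-ratio profile at the root (stub `stub_rootLogDerivGrowth`)

Landing target:
`Summits/CriticalPhenomena/SAWScalingLimit/Theorems/SAWDevelopingMapHexConjectureRootGrowth.lean`
(`--supports stmt-CriticalPhenomena-0808`; lead continuation prover-line-stmt-CriticalPhenomena-0808-c6-0).

For a floor-type Dobrushin domain `(E; a, b)` (flat half-disc of radius `ρ` at the root `a = E.pt 0`), a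
chordal uniformizing map `ψ : (ℍ; 0, ∞) → (E; a, b)` and the half-plane map `Ψ = -1/ψ⁻¹ : E → ℍ`
(`a ↦ ∞`), `rootLogDerivGrowth` bounds the boundary values `Ls` of a continuous logarithm `L` of `Ψ'`
at the floor points `a + t`, `0 < t < r`, from BELOW: `log κ - 2 log t ≤ Re Ls`, i.e. `|Ψ'(a + t)| ≥ κ/t²`
(the simple pole of `Ψ` at the root), so that the boundary profile
`G(t) = |Ψ'(a + t)/Ψ'(b)|^{5/8}` grows at least like `t^{-5/4}`.  Proof:
* `χ = ψ⁻¹ : E → ℍ` tends to `0` at `a` and to nonzero reals at the other points of the diameter of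
  the half-disc (Carathéodory, `IsChordalUniformizing.tendsto_symm_nhds_zero`,
  `….exists_tendsto_symm_of_mem_frontier`), so by the landed Schwarz-reflection lemma
  `exists_tendsto_log_deriv_of_flat` a continuous logarithm of `χ'` has a limit at `a`: `χ' → μ ≠ 0`;
* on a small half-disc `W = E ∩ B(a, r)` (convex) `‖χ'‖ ≤ 2‖μ‖` and `‖χ'‖ ≥ ‖μ‖/2`, so by the mean value
  inequality and `χ → 0` at `a`, `‖χ z‖ ≤ 2‖μ‖ ‖z - a‖`, whence
  `‖Ψ' z‖ = ‖χ' z‖/‖χ z‖² ≥ 1/(8‖μ‖ ‖z - a‖²)` on `W`;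
* letting `z → a + t` inside `E` (`‖Ψ'‖ = exp (Re L) → exp (Re Ls)`) gives `exp (Re Ls) t² ≥ 1/(8‖μ‖)`.
The file also provides the floor-point plumbing consumed by the sibling `…ConformalPackageGrowth`:
limits of `L` at every point of the punctured diameter (`exists_tendsto_log_deriv_floorPoint`),
continuity of the boundary extension along the floor (`continuousOn_extendFrom_floor`) and the
`t^{-5/4}` algebra (`exp_growth_rpow`).
-/

noncomputable section

open scoped Topology
open Filter Set Metric Complex
open Literature.Probability.RandomPlanarGeometry
open UpperHalfPlane (upperHalfPlaneSet isOpen_upperHalfPlaneSet)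

namespace Summit.CriticalPhenomena.SAWScalingLimit.Theorems.HexConjecture.RootLocality

open Summit.CriticalPhenomena.SAWScalingLimit.Theorems.ObservableToSLE.FloorRatio

/-! ### Floor-point plumbing -/

/-- **Boundary limits of `log Ψ'` along a flat floor.**  If `U ∩ B(x, ρ)` is the upper half-disc and
the conformal map `Ψ : U → ℍ` has a real boundary value at every frontier point other than `x`, then
every continuous logarithm `L` of `Ψ'` has a limit from inside `U` at each point `x + t`,
`0 < |t| < ρ`, of the punctured diameter (`exists_tendsto_log_deriv_of_flat` on the half-disc
`B(x + t, min |t| (ρ - |t|))`, whose diameter avoids `x`). [folklore] -/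
theorem exists_tendsto_log_deriv_floorPoint {U : Set ℂ} (Ψ : ConformalEquiv U upperHalfPlaneSet)
    {x : ℂ} {ρ : ℝ} (hflat : U ∩ ball x ρ = {z : ℂ | x.im < z.im} ∩ ball x ρ)
    (hreal : ∀ p ∈ frontier U, p ≠ x → ∃ σ : ℝ, Ψ.HasBoundaryValue p σ)
    {L : ℂ → ℂ} (hLc : ContinuousOn L U) (hLe : ∀ z ∈ U, exp (L z) = deriv Ψ z)
    {t : ℝ} (ht0 : t ≠ 0) (ht : |t| < ρ) :
    ∃ Ls : ℂ, Tendsto L (𝓝[U] (x + t)) (𝓝 Ls) := by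
  set r : ℝ := min |t| (ρ - |t|) with hr
  have hrpos : 0 < r := lt_min (abs_pos.2 ht0) (sub_pos.2 ht)
  have hrt : r ≤ |t| := min_le_left _ _
  have hrρ : r ≤ ρ - |t| := min_le_right _ _
  have hims : (x + (t : ℂ)).im = x.im := by simp
  have hballs : ball (x + (t : ℂ)) r ⊆ ball x ρ := by
    intro z hz
    rw [mem_ball] at hz ⊢
    have hdt : dist (x + (t : ℂ)) x = |t| := by
      rw [dist_eq_norm, add_sub_cancel_left, norm_real, Real.norm_eq_abs]
    calc dist z x ≤ dist z (x + t) + dist (x + (t : ℂ)) x := dist_triangle _ _ _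
      _ < r + |t| := by rw [hdt]; linarith
      _ ≤ ρ := by linarith
  have hflats : U ∩ ball (x + t) r = {z : ℂ | (x + (t : ℂ)).im < z.im} ∩ ball (x + t) r :=
    flat_of_subset hflat hballs hims
  have hbv : ∀ t' : ℝ, |t'| < r → ∃ σ : ℝ, Tendsto Ψ (𝓝[U] (x + t + t')) (𝓝 (σ : ℂ)) := by
    intro t' ht'
    have h1 : |t + t'| < ρ := by
      calc |t + t'| ≤ |t| + |t'| := abs_add_le _ _
        _ < ρ := by linarith
    have h2 : t + t' ≠ 0 := by
      intro h
      have : |t| = |t'| := by rw [show t = -t' by linarith, abs_neg]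
      linarith
    have he : x + (t : ℂ) + t' = x + ((t + t' : ℝ) : ℂ) := by push_cast; ring
    have hfr : x + (t : ℂ) + t' ∈ frontier U := by
      rw [he]; exact mem_frontier_of_flat hflat h1
    have hne : x + (t : ℂ) + t' ≠ x := fun h => h2 (by
      have := congrArg Complex.re h
      simpa [add_assoc] using this)
    exact hreal _ hfr hne
  exact exists_tendsto_log_deriv_of_flat Ψ hrpos hflats hbv hLc hLe

/-- **Continuity of the boundary extension along a flat floor.**  If `U ∩ B(x, ρ)` is the upper
half-disc and `L` has a limit from inside `U` at every point `x + t`, `0 < t < ρ`, then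
`t ↦ extendFrom U L (x + t)` is continuous on `(0, ρ)` (`continuousOn_extendFrom`: the floor segment
lies in `closure U`). [folklore] -/
theorem continuousOn_extendFrom_floor {U : Set ℂ} {x : ℂ} {ρ : ℝ}
    (hflat : U ∩ ball x ρ = {z : ℂ | x.im < z.im} ∩ ball x ρ) {L : ℂ → ℂ}
    (hlim : ∀ t : ℝ, 0 < t → t < ρ → ∃ Ls : ℂ, Tendsto L (𝓝[U] (x + t)) (𝓝 Ls)) :
    ContinuousOn (fun t : ℝ => extendFrom U L (x + t)) (Ioo 0 ρ) := by
  set T : Set ℂ := (fun t : ℝ => x + t) '' Ioo 0 ρ with hT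
  have hTsub : T ⊆ closure U := by
    rintro _ ⟨t, ht, rfl⟩
    exact frontier_subset_closure
      (mem_frontier_of_flat hflat (by rw [abs_of_pos ht.1]; exact ht.2))
  have hlim' : ∀ z ∈ T, ∃ y, Tendsto L (𝓝[U] z) (𝓝 y) := by
    rintro _ ⟨t, ht, rfl⟩
    exact hlim t ht.1 ht.2
  have hcont : ContinuousOn (extendFrom U L) T := continuousOn_extendFrom hTsub hlim'
  have hc : Continuous fun t : ℝ => x + (t : ℂ) := by fun_prop
  exact hcont.comp hc.continuousOn fun t ht => ⟨t, ht, rfl⟩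

/-- The `t^{-5/4}` algebra of the growth bound: `log κ - 2 log t ≤ x` gives
`exp ((5/8)(log κ - c)) · t^{-5/4} ≤ exp ((5/8)(x - c))` for `t > 0`. [folklore] -/
theorem exp_growth_rpow {κ t c x : ℝ} (ht : 0 < t) (h : Real.log κ - 2 * Real.log t ≤ x) :
    Real.exp ((5 / 8) * (Real.log κ - c)) * t ^ (-(5 / 4 : ℝ)) ≤ Real.exp ((5 / 8) * (x - c)) := by
  rw [Real.rpow_def_of_pos ht, ← Real.exp_add, Real.exp_le_exp]
  linarith

/-! ### Growth of `log Ψ'` at the root -/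

/-- **Growth of `log |Ψ'|` at the root.**  For a floor-type Dobrushin domain `(E; a, b)` (flat
half-disc of radius `ρ` at `a = E.pt 0`), a chordal uniformizing map `ψ` and the half-plane map
`Ψ = -1/ψ⁻¹ : E → ℍ`, there are `κ > 0` and `r > 0` such that every boundary value `Ls` of a
logarithm `L` of `Ψ'` (continuity of `L` is not needed) at a floor point `a + t`, `0 < t < r`, satisfies
`log κ - 2 log t ≤ Re Ls` (`|Ψ'(a + t)| ≥ κ/t²`: `ψ⁻¹` extends across the diameter by Schwarz
reflection with `(ψ⁻¹)'(a) = μ ≠ 0`, and `Ψ' = (ψ⁻¹)'/(ψ⁻¹)²`).  See the module docstring.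
[folklore] -/
theorem rootLogDerivGrowth (E : DobrushinDomain) (ψ : ConformalEquiv upperHalfPlaneSet E.carrier)
    (hψ : E.IsChordalUniformizing ψ) {ρ : ℝ} (hρ : 0 < ρ)
    (hflat : E.carrier ∩ ball (E.pt 0) ρ = {z : ℂ | (E.pt 0).im < z.im} ∩ ball (E.pt 0) ρ)
    (Ψ : ConformalEquiv E.carrier upperHalfPlaneSet) (hΨ : ∀ z, Ψ z = -(ψ.symm z)⁻¹)
    {L : ℂ → ℂ} (hLe : ∀ z ∈ E.carrier, exp (L z) = deriv Ψ z) :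
    ∃ κ : ℝ, 0 < κ ∧ ∃ r : ℝ, 0 < r ∧ ∀ t : ℝ, 0 < t → t < r → ∀ Ls : ℂ,
      Tendsto L (𝓝[E.carrier] (E.pt 0 + t)) (𝓝 Ls) → Real.log κ - 2 * Real.log t ≤ Ls.re := by
  -- names: `a = E.pt 0`, `χ = ψ⁻¹ : E → ℍ`
  have hUo : IsOpen E.carrier := E.isOpen
  have hχ0 : Tendsto ψ.symm (𝓝[E.carrier] (E.pt 0)) (𝓝 0) := hψ.tendsto_symm_nhds_zero
  have haU : E.pt 0 ∈ closure E.carrier := frontier_subset_closure (E.pt_mem_frontier 0)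
  have hab : E.pt 0 ≠ E.pt 1 := fun h => absurd (E.pt_injective h) (by decide)
  set a : ℂ := E.pt 0 with ha
  have hdab : 0 < dist a (E.pt 1) := dist_pos.2 hab
  -- Step 1: a continuous logarithm `M` of `χ'` and its limit at `a` (Schwarz reflection)
  obtain ⟨M, hMc, hMe⟩ := exists_log_deriv E.toJordanDomain ψ.symm
  set r₀ : ℝ := min ρ (dist a (E.pt 1)) with hr₀
  have hr₀pos : 0 < r₀ := lt_min hρ hdab
  have hr₀ρ : r₀ ≤ ρ := min_le_left _ _
  have hr₀d : r₀ ≤ dist a (E.pt 1) := min_le_right _ _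
  have hflat₀ : E.carrier ∩ ball a r₀ = {z : ℂ | a.im < z.im} ∩ ball a r₀ :=
    flat_of_subset hflat (ball_subset_ball hr₀ρ) rfl
  have hbv : ∀ t : ℝ, |t| < r₀ →
      ∃ σ : ℝ, Tendsto ψ.symm (𝓝[E.carrier] (a + t)) (𝓝 (σ : ℂ)) := by
    intro t ht
    by_cases ht0 : t = 0
    · subst ht0
      refine ⟨0, ?_⟩
      simpa using hχ0
    · have hfr : a + (t : ℂ) ∈ frontier E.carrier :=
        mem_frontier_of_flat hflat (ht.trans_le hr₀ρ)
      have hne_a : a + (t : ℂ) ≠ a := fun h => ht0 (by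
        have := congrArg Complex.re h
        simpa using this)
      have hne_b : a + (t : ℂ) ≠ E.pt 1 := by
        intro h
        have : dist a (E.pt 1) = |t| := by
          rw [← h, dist_eq_norm, show a - (a + t) = -(t : ℂ) by ring, norm_neg, norm_real,
            Real.norm_eq_abs]
        linarith
      obtain ⟨q, -, hq⟩ := hψ.exists_tendsto_symm_of_mem_frontier hfr hne_a hne_b
      exact ⟨q, hq⟩
  obtain ⟨Ma, hMa⟩ := exists_tendsto_log_deriv_of_flat ψ.symm hr₀pos hflat₀ hbv hMc hMe
  -- Step 2: `χ' → μ ≠ 0` at `a`; the half-disc `W` on which `‖χ' - μ‖ < ‖μ‖/2`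
  set μ : ℂ := exp Ma with hμ
  have hμ0 : 0 < ‖μ‖ := norm_pos_iff.2 (exp_ne_zero Ma)
  have hdχ : Tendsto (deriv ψ.symm) (𝓝[E.carrier] a) (𝓝 μ) := by
    refine ((continuous_exp.tendsto Ma).comp hMa).congr' ?_
    filter_upwards [self_mem_nhdsWithin] with z hz
    exact hMe z hz
  obtain ⟨r₁, hr₁pos, hr₁r₀, hr₁⟩ : ∃ r₁, 0 < r₁ ∧ r₁ ≤ r₀ ∧
      ∀ z ∈ ball a r₁, z ∈ E.carrier → ‖deriv ψ.symm z - μ‖ < ‖μ‖ / 2 := by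
    have hev : ∀ᶠ z in 𝓝[E.carrier] a, dist (deriv ψ.symm z) μ < ‖μ‖ / 2 :=
      Metric.tendsto_nhds.1 hdχ _ (half_pos hμ0)
    rw [eventually_nhdsWithin_iff, Metric.eventually_nhds_iff_ball] at hev
    obtain ⟨ε, hε, hεb⟩ := hev
    exact ⟨min ε r₀, lt_min hε hr₀pos, min_le_right _ _, fun z hz hzU => by
      rw [← dist_eq_norm]; exact hεb z (ball_subset_ball (min_le_left _ _) hz) hzU⟩
  set W : Set ℂ := E.carrier ∩ ball a r₁ with hW
  have hWflat : W = {z : ℂ | a.im < z.im} ∩ ball a r₁ :=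
    flat_of_subset hflat (ball_subset_ball (hr₁r₀.trans hr₀ρ)) rfl
  have hWconv : Convex ℝ W := by
    rw [hWflat]; exact (convex_halfSpace_im_gt a.im).inter (convex_ball a r₁)
  have hWU : W ⊆ E.carrier := inter_subset_left
  have hWmem : ∀ p ∈ ball a r₁, W ∈ 𝓝[E.carrier] p := fun p hp =>
    inter_mem self_mem_nhdsWithin (mem_nhdsWithin_of_mem_nhds (isOpen_ball.mem_nhds hp))
  have hup : ∀ z ∈ W, ‖deriv ψ.symm z‖ ≤ 2 * ‖μ‖ := by
    intro z hz
    have h := hr₁ z hz.2 hz.1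
    calc ‖deriv ψ.symm z‖ = ‖(deriv ψ.symm z - μ) + μ‖ := by rw [sub_add_cancel]
      _ ≤ ‖deriv ψ.symm z - μ‖ + ‖μ‖ := norm_add_le _ _
      _ ≤ 2 * ‖μ‖ := by linarith
  have hlow : ∀ z ∈ W, ‖μ‖ / 2 ≤ ‖deriv ψ.symm z‖ := by
    intro z hz
    have h := hr₁ z hz.2 hz.1
    have : ‖μ‖ ≤ ‖μ - deriv ψ.symm z‖ + ‖deriv ψ.symm z‖ := by
      calc ‖μ‖ = ‖(μ - deriv ψ.symm z) + deriv ψ.symm z‖ := by rw [sub_add_cancel]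
        _ ≤ _ := norm_add_le _ _
    rw [norm_sub_rev] at this
    linarith
  -- Step 3: mean value inequality on the convex `W`: `‖ψ.symm z‖ ≤ 2‖μ‖ ‖z - a‖`
  have hχd : ∀ z ∈ W, DifferentiableAt ℂ ψ.symm z := fun z hz =>
    (ψ.symm.differentiableOn_coe z (hWU hz)).differentiableAt (hUo.mem_nhds (hWU hz))
  have hmv : ∀ z ∈ W, ∀ z' ∈ W, ‖ψ.symm z - ψ.symm z'‖ ≤ 2 * ‖μ‖ * ‖z - z'‖ := fun z hz z' hz' =>
    hWconv.norm_image_sub_le_of_norm_deriv_le hχd hup hz' hz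
  haveI : (𝓝[E.carrier] a).NeBot := mem_closure_iff_nhdsWithin_neBot.1 haU
  have hid : Tendsto (fun z' : ℂ => z') (𝓝[E.carrier] a) (𝓝 a) := tendsto_id.mono_left nhdsWithin_le_nhds
  have hχa : ∀ z ∈ W, ‖ψ.symm z‖ ≤ 2 * ‖μ‖ * ‖z - a‖ := by
    intro z hz
    have h1 : Tendsto (fun z' => ‖ψ.symm z - ψ.symm z'‖ - 2 * ‖μ‖ * ‖z - z'‖) (𝓝[E.carrier] a)
        (𝓝 (‖ψ.symm z - 0‖ - 2 * ‖μ‖ * ‖z - a‖)) :=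
      (tendsto_const_nhds.sub hχ0).norm.sub ((tendsto_const_nhds.sub hid).norm.const_mul _)
    have h2 : ‖ψ.symm z - 0‖ - 2 * ‖μ‖ * ‖z - a‖ ≤ 0 := by
      refine le_of_tendsto h1 ?_
      filter_upwards [hWmem a (mem_ball_self hr₁pos)] with z' hz'
      linarith [hmv z hz z' hz']
    rw [sub_zero] at h2
    linarith
  -- Step 4: `Ψ = -1/χ`, `Ψ' = χ'/χ²`, and `κ ≤ exp (Re L z) ‖z - a‖²` on `W`
  have hχne : ∀ z ∈ E.carrier, ψ.symm z ≠ 0 := by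
    intro z hz h0
    have : (0 : ℂ) ∈ upperHalfPlaneSet := h0 ▸ ψ.symm.mapsTo hz
    simp [upperHalfPlaneSet] at this
  have hdΨ : ∀ z ∈ E.carrier, deriv Ψ z = deriv ψ.symm z / (ψ.symm z) ^ 2 := by
    intro z hz
    have hχ' : HasDerivAt ψ.symm (deriv ψ.symm z) z :=
      ((ψ.symm.differentiableOn_coe z hz).differentiableAt (hUo.mem_nhds hz)).hasDerivAt
    have h : HasDerivAt (fun w => -(ψ.symm w)⁻¹) (-(-(deriv ψ.symm z) / (ψ.symm z) ^ 2)) z :=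
      (hχ'.inv (hχne z hz)).neg
    have h' : HasDerivAt Ψ (-(-(deriv ψ.symm z) / (ψ.symm z) ^ 2)) z :=
      h.congr_of_eventuallyEq (Eventually.of_forall fun w => hΨ w)
    rw [h'.deriv]
    ring
  set κ : ℝ := 1 / (8 * ‖μ‖) with hκ
  have hκpos : 0 < κ := by positivity
  have hkey : ∀ z ∈ W, κ ≤ Real.exp (L z).re * ‖z - a‖ ^ 2 := by
    intro z hz
    have hzU : z ∈ E.carrier := hWU hz
    have hχz : 0 < ‖ψ.symm z‖ := norm_pos_iff.2 (hχne z hzU)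
    have hA := hlow z hz
    have hB := hχa z hz
    have hnorm : Real.exp (L z).re = ‖deriv ψ.symm z‖ / ‖ψ.symm z‖ ^ 2 := by
      rw [← Complex.norm_exp, hLe z hzU, hdΨ z hzU, norm_div, norm_pow]
    rw [hnorm, hκ, div_mul_eq_mul_div, div_le_div_iff₀ (by positivity) (pow_pos hχz 2), one_mul]
    calc ‖ψ.symm z‖ ^ 2 ≤ (2 * ‖μ‖ * ‖z - a‖) ^ 2 := by gcongr
      _ = ‖μ‖ / 2 * ‖z - a‖ ^ 2 * (8 * ‖μ‖) := by ring
      _ ≤ ‖deriv ψ.symm z‖ * ‖z - a‖ ^ 2 * (8 * ‖μ‖) := by gcongr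
  -- Step 5: pass to the limit at the floor points `a + t`, `0 < t < r₁`
  refine ⟨κ, hκpos, r₁, hr₁pos, fun t ht htr Ls hLs => ?_⟩
  have hsU : a + (t : ℂ) ∈ closure E.carrier :=
    frontier_subset_closure (mem_frontier_of_flat hflat (by
      rw [abs_of_pos ht]; exact htr.trans_le (hr₁r₀.trans hr₀ρ)))
  haveI : (𝓝[E.carrier] (a + (t : ℂ))).NeBot := mem_closure_iff_nhdsWithin_neBot.1 hsU
  have hsb : a + (t : ℂ) ∈ ball a r₁ := by
    rw [mem_ball, dist_eq_norm, add_sub_cancel_left, norm_real, Real.norm_eq_abs, abs_of_pos ht]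
    exact htr
  have hlim : Tendsto (fun z => Real.exp (L z).re * ‖z - a‖ ^ 2) (𝓝[E.carrier] (a + t))
      (𝓝 (Real.exp Ls.re * t ^ 2)) := by
    have h1 : Tendsto (fun z => Real.exp (L z).re) (𝓝[E.carrier] (a + t)) (𝓝 (Real.exp Ls.re)) :=
      (Real.continuous_exp.tendsto _).comp ((continuous_re.tendsto _).comp hLs)
    have h2 : Tendsto (fun z : ℂ => ‖z - a‖ ^ 2) (𝓝[E.carrier] (a + t)) (𝓝 (t ^ 2)) := by
      have hc : Continuous fun z : ℂ => ‖z - a‖ ^ 2 := by fun_prop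
      have := (hc.tendsto (a + t)).mono_left (nhdsWithin_le_nhds (s := E.carrier))
      rwa [add_sub_cancel_left, norm_real, Real.norm_eq_abs, abs_of_pos ht] at this
    exact h1.mul h2
  have hle : κ ≤ Real.exp Ls.re * t ^ 2 :=
    ge_of_tendsto hlim (by
      filter_upwards [hWmem _ hsb] with z hz
      exact hkey z hz)
  have hlog := Real.log_le_log hκpos hle
  rw [Real.log_mul (Real.exp_pos _).ne' (pow_pos ht 2).ne', Real.log_exp, Real.log_pow] at hlog
  push_cast at hlog
  linarith

/-! ### Registered form -/

/-- **Registered sub-goal `stub_rootLogDerivGrowth`** (crux item stmt-CriticalPhenomena-0808, line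
`root-locality-replaces-loewner`, lead continuation c6): growth `log κ - 2 log t ≤ Re Ls` of the
log-derivative of the half-plane map `Ψ = -1/ψ⁻¹` at the floor points near the root
(`rootLogDerivGrowth`), signature fully qualified. [folklore] -/
theorem stub_rootLogDerivGrowth : ∀ (E : Literature.Probability.RandomPlanarGeometry.DobrushinDomain) (ψ : Literature.Probability.RandomPlanarGeometry.ConformalEquiv UpperHalfPlane.upperHalfPlaneSet E.carrier), E.IsChordalUniformizing ψ → ∀ (ρ : ℝ), 0 < ρ → E.carrier ∩ Metric.ball (E.pt 0) ρ = {z : ℂ | (E.pt 0).im < z.im} ∩ Metric.ball (E.pt 0) ρ → ∀ (Ψ : Literature.Probability.RandomPlanarGeometry.ConformalEquiv E.carrier UpperHalfPlane.upperHalfPlaneSet), (∀ z, Ψ z = -(ψ.symm z)⁻¹) → ∀ (L : ℂ → ℂ), ContinuousOn L E.carrier → (∀ z ∈ E.carrier, Complex.exp (L z) = deriv Ψ z) → ∃ κ : ℝ, 0 < κ ∧ ∃ r : ℝ, 0 < r ∧ ∀ t : ℝ, 0 < t → t < r → ∀ Ls : ℂ, Filter.Tendsto L (nhdsWithin (E.pt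 0 + t) E.carrier) (nhds Ls) → Real.log κ - 2 * Real.log t ≤ Ls.re :=
  fun E ψ hψ _ hρ hflat Ψ hΨ _ _ hLe => rootLogDerivGrowth E ψ hψ hρ hflat Ψ hΨ hLe

end Summit.CriticalPhenomena.SAWScalingLimit.Theorems.HexConjecture.RootLocality

end
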